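import Mathlib
import Summits.QuantumAdvantage.QuantumAdvantage.Theorems.MobiusLadderQuadraticDigitPhasesStubCompactLemmas
import Summits.QuantumAdvantage.QuantumAdvantage.Theorems.MobiusLadderQuadraticDigitPhasesStubCompactLemmas2

/-!
# Compactness for banded quadratic digit phases (stub `stub_compact`)

Crux `MobiusLadder.QuadraticDigitPhases` (stmt-QuantumAdvantage-1391), line `Sketch`, stub
`stub_compact`: UNIFORM `ε`-orthogonality of `λ` to the phases `(-1)^{Q(bits_n N)}` of all `s`-BANDED
quadratic polynomials `Q` (total degree `≤ 2`, the variables of every monomial pairwise within distance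
`s`) follows from a PER-SEQUENCE hypothesis `hM` on every INFINITE `s`-banded form `(quad, lin)`: the
dyadic block statistic `Σ_b |Σ_{a<2^k} λ(2^k b + a) (-1)^{form(2^k b + a)}|` is `≤ ε 2^n` for `k`, then `n`,
large.

Proof (classical compactness, here via an ultrafilter instead of König's lemma).  If the conclusion
fails for `ε`, the set of bad `n` is unbounded; choose a bad banded `Q_n` for each.  By the normal form
(`eval_bits_eq`), `Q_n(bits N) = c₀ + Σ qd_n i j xᵢ xⱼ + Σ ld_n i xᵢ` with `qd_n`, `ld_n` read off from
the coefficients of `Q_n`.  Along a free ultrafilter `U` containing the bad set, every finite window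
`(qd_n, ld_n)|_{<k}` is eventually constant (finitely many values), which defines a coherent infinite
banded form `(quad, lin)`.  Apply `hM` to it with `ε`: for some block exponent `j` the block statistic
is eventually `≤ ε 2^n`; pick `n` `U`-large: bad, `≥ j + s`, and with `(qd_n, ld_n) = (quad, lin)` on
the window `[0, j + s)`.  Bandedness makes the two forms differ only in digits `≥ j` (plus a constant),
so THE CUT (`abs_corr_le_block`) bounds `|corr_n(Q_n)|` by the block statistic, `≤ ε 2^n` —
contradicting badness.
-/

set_option linter.dupNamespace false -- D-0017: single-problem summit ⇒ QuantumAdvantage.QuantumAdvantage by design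

namespace Summit.QuantumAdvantage.QuantumAdvantage.Theorems.MobiusLadderQuadraticDigitPhasesStubCompact

open Finset Filter

/-- COMPACTNESS (stub `stub_compact` of `MobiusLadder.QuadraticDigitPhases`, line `Sketch`).  If for
every infinite `s`-banded quadratic form (`quad i j ≠ 0 → i < j ≤ i + s`, arbitrary linear part `lin`)
the dyadic block statistic of its phase against `λ` is `≤ ε 2^n` for all large block exponents `k` and
then all large `n`, then the phases of the finite `s`-banded quadratic polynomials `Q` over `ZMod 2`
(total degree `≤ 2`, variables of each monomial pairwise within distance `s`) are UNIFORMLY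
`ε`-orthogonal to `λ` on `[0, 2^n)` for all large `n`. -/
theorem stub_compact (s : ℕ)
    (hM : ∀ (quad : ℕ → ℕ → ZMod 2) (lin : ℕ → ZMod 2),
      (∀ i j, quad i j ≠ 0 → i < j ∧ j ≤ i + s) →
      ∀ ε : ℝ, 0 < ε → ∀ᶠ k : ℕ in atTop, ∀ᶠ n : ℕ in atTop,
        ∑ b ∈ range (2 ^ (n - k)),
          |∑ a ∈ range (2 ^ k), ((ArithmeticFunction.liouville (2 ^ k * b + a) : ℤ) : ℝ) *
            (if (∑ i ∈ range (2 ^ k * b + a + 1), ∑ j ∈ range (2 ^ k * b + a + 1),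
                    quad i j * (if Nat.testBit (2 ^ k * b + a) i then (1 : ZMod 2) else 0) *
                      (if Nat.testBit (2 ^ k * b + a) j then (1 : ZMod 2) else 0)) +
                  ∑ i ∈ range (2 ^ k * b + a + 1),
                    lin i * (if Nat.testBit (2 ^ k * b + a) i then (1 : ZMod 2) else 0) = 1
              then (-1 : ℝ) else 1)| ≤ ε * (2 : ℝ) ^ n) :
    ∀ ε : ℝ, 0 < ε → ∀ᶠ n : ℕ in atTop, ∀ Q : MvPolynomial (Fin n) (ZMod 2),
      Q.totalDegree ≤ 2 →
      (∀ m ∈ Q.support, ∀ i ∈ m.support, ∀ j ∈ m.support, Nat.dist i j ≤ s) →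
      |∑ N ∈ range (2 ^ n), ((ArithmeticFunction.liouville N : ℤ) : ℝ) *
          (if MvPolynomial.eval (fun i : Fin n => if Nat.testBit N i then (1 : ZMod 2) else 0) Q = 1
            then (-1 : ℝ) else 1)| ≤ ε * (2 : ℝ) ^ n := by
  classical
  intro ε hε
  by_contra hcon
  -- `Good n Q`: the conclusion for a single polynomial `Q` on `n` digits
  obtain ⟨Good, hGood⟩ : ∃ Good : (n : ℕ) → MvPolynomial (Fin n) (ZMod 2) → Prop, ∀ n Q, Good n Q ↔
      (Q.totalDegree ≤ 2 →
        (∀ m ∈ Q.support, ∀ i ∈ m.support, ∀ j ∈ m.support, Nat.dist i j ≤ s) →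
        |∑ N ∈ range (2 ^ n), ((ArithmeticFunction.liouville N : ℤ) : ℝ) *
            (if MvPolynomial.eval (fun i : Fin n => if Nat.testBit N i then (1 : ZMod 2) else 0) Q = 1
              then (-1 : ℝ) else 1)| ≤ ε * (2 : ℝ) ^ n) := ⟨_, fun _ _ => Iff.rfl⟩
  have hfreq : ∃ᶠ n in atTop, ¬ ∀ Q, Good n Q :=
    Filter.not_eventually.mp fun h => hcon (h.mono fun n hn Q => (hGood n Q).mp (hn Q))
  -- a bad polynomial `Q n` for every bad `n`
  have hch : ∀ n, ∃ Q : MvPolynomial (Fin n) (ZMod 2), (¬ ∀ Q', Good n Q') → ¬ Good n Q := by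
    intro n
    by_cases hb : ∀ Q', Good n Q'
    · exact ⟨0, fun h => absurd hb h⟩
    · obtain ⟨Q, hQ⟩ := not_forall.mp hb
      exact ⟨Q, fun _ => hQ⟩
  choose Q hQ using hch
  have hbad : ∀ n, (¬ ∀ Q', Good n Q') →
      (Q n).totalDegree ≤ 2 ∧
      (∀ m ∈ (Q n).support, ∀ i ∈ m.support, ∀ j ∈ m.support, Nat.dist i j ≤ s) ∧
      ¬ |∑ N ∈ range (2 ^ n), ((ArithmeticFunction.liouville N : ℤ) : ℝ) *
          (if MvPolynomial.eval (fun i : Fin n => if Nat.testBit N i then (1 : ZMod 2) else 0) (Q n) = 1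
            then (-1 : ℝ) else 1)| ≤ ε * (2 : ℝ) ^ n := by
    intro n hn
    have h := hQ n hn
    rw [hGood] at h
    push Not at h
    exact ⟨h.1, h.2.1, not_le.mpr h.2.2⟩
  -- the coefficient data of `Q n` as functions on `ℕ`
  obtain ⟨qd, hqd⟩ : ∃ qd : ℕ → ℕ → ℕ → ZMod 2, ∀ n i j, qd n i j =
      if h : i < j ∧ j < n then MvPolynomial.coeff (Finsupp.single (⟨i, h.1.trans h.2⟩ : Fin n) 1 +
        Finsupp.single (⟨j, h.2⟩ : Fin n) 1) (Q n) else 0 := ⟨_, fun _ _ _ => rfl⟩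
  obtain ⟨ld, hld⟩ : ∃ ld : ℕ → ℕ → ZMod 2, ∀ n i, ld n i =
      if h : i < n then MvPolynomial.coeff (Finsupp.single (⟨i, h⟩ : Fin n) 1) (Q n) +
        MvPolynomial.coeff (Finsupp.single (⟨i, h⟩ : Fin n) 2) (Q n) else 0 := ⟨_, fun _ _ => rfl⟩
  -- normal form and bandedness at every bad `n`
  have hNF : ∀ n, (¬ ∀ Q', Good n Q') → ∀ N : ℕ,
      MvPolynomial.eval (fun i : Fin n => if Nat.testBit N i then (1 : ZMod 2) else 0) (Q n) =
        MvPolynomial.coeff 0 (Q n) +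
          ((∑ i ∈ range n, ∑ j ∈ range n, qd n i j * (if Nat.testBit N i then (1 : ZMod 2) else 0) *
              (if Nat.testBit N j then (1 : ZMod 2) else 0)) +
            ∑ i ∈ range n, ld n i * (if Nat.testBit N i then (1 : ZMod 2) else 0)) := by
    intro n hn N
    refine eval_bits_eq (Q n) (hbad n hn).1 (qd n) (ld n) (fun i j => ?_) (fun i => ?_) N
    · rw [hqd]
      by_cases hij : i < j
      · rw [if_pos hij, dif_pos ⟨hij, j.isLt⟩]
      · rw [if_neg hij, dif_neg fun h => hij h.1]
    · rw [hld, dif_pos i.isLt]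
  have hBD : ∀ n, (¬ ∀ Q', Good n Q') → ∀ i j, qd n i j ≠ 0 → i < j ∧ j ≤ i + s := by
    intro n hn i j hne
    rw [hqd] at hne
    split_ifs at hne with h
    · exact ⟨h.1, coeff_pair_banded (hbad n hn).2.1
        (show (⟨i, h.1.trans h.2⟩ : Fin n) < ⟨j, h.2⟩ from h.1) hne⟩
    · exact absurd rfl hne
  -- a free ultrafilter on the bad set
  haveI : NeBot (atTop ⊓ 𝓟 {n : ℕ | ¬ ∀ Q', Good n Q'}) := Filter.frequently_iff_neBot.mp hfreq
  obtain ⟨U, hUle⟩ : ∃ U : Ultrafilter ℕ, (U : Filter ℕ) ≤ atTop ⊓ 𝓟 {n : ℕ | ¬ ∀ Q', Good n Q'} :=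
    ⟨Ultrafilter.of _, Ultrafilter.of_le _⟩
  have hUtop : (U : Filter ℕ) ≤ atTop := hUle.trans inf_le_left
  have hUbad : ∀ᶠ n in (U : Filter ℕ), ¬ ∀ Q', Good n Q' :=
    hUle (mem_inf_of_right (mem_principal_self _))
  -- the windows `(qd n, ld n)|_{<k}` are `U`-eventually constant
  have hv : ∀ k : ℕ, ∃ v : (Fin k → Fin k → ZMod 2) × (Fin k → ZMod 2),
      ∀ᶠ n in (U : Filter ℕ), ((fun i j : Fin k => qd n i j), (fun i : Fin k => ld n i)) = v :=
    fun k => (Ultrafilter.eventually_exists_iff (f := U)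
      (P := fun v n => ((fun i j : Fin k => qd n i j), (fun i : Fin k => ld n i)) = v)).mp
        (Eventually.of_forall fun n => ⟨_, rfl⟩)
  choose v hv using hv
  -- the limit form
  obtain ⟨quad, hquad⟩ : ∃ quad : ℕ → ℕ → ZMod 2, ∀ i j, quad i j =
      if h : i < j then (v (j + 1)).1 ⟨i, h.trans (Nat.lt_add_one j)⟩ ⟨j, Nat.lt_add_one j⟩ else 0 :=
    ⟨_, fun _ _ => rfl⟩
  obtain ⟨lin, hlin⟩ : ∃ lin : ℕ → ZMod 2, ∀ i, lin i = (v (i + 1)).2 ⟨i, Nat.lt_add_one i⟩ :=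
    ⟨_, fun _ => rfl⟩
  have hCq : ∀ i j : ℕ, ∀ᶠ n in (U : Filter ℕ), qd n i j = quad i j := by
    intro i j
    by_cases hij : i < j
    · filter_upwards [hv (j + 1)] with n hn
      rw [hquad, dif_pos hij]
      exact congrFun (congrFun (congrArg Prod.fst hn) ⟨i, hij.trans (Nat.lt_add_one j)⟩)
        ⟨j, Nat.lt_add_one j⟩
    · refine Eventually.of_forall fun n => ?_
      rw [hquad, dif_neg hij, hqd, dif_neg fun h => hij h.1]
  have hCl : ∀ i : ℕ, ∀ᶠ n in (U : Filter ℕ), ld n i = lin i := by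
    intro i
    filter_upwards [hv (i + 1)] with n hn
    rw [hlin]
    exact congrFun (congrArg Prod.snd hn) ⟨i, Nat.lt_add_one i⟩
  have hband : ∀ i j, quad i j ≠ 0 → i < j ∧ j ≤ i + s := by
    intro i j hne
    obtain ⟨n, hn1, hn2⟩ := ((hCq i j).and hUbad).exists
    rw [← hn1] at hne
    exact hBD n hn2 i j hne
  -- the hypothesis for the limit form, at `ε`
  obtain ⟨j, hj⟩ := (hM quad lin hband ε hε).exists
  have hco : ∀ᶠ n in (U : Filter ℕ), ∀ i i' : Fin (j + s), qd n i i' = quad i i' ∧ ld n i = lin i := by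
    simp only [Filter.eventually_all]
    exact fun i i' => (hCq i i').and (hCl i)
  obtain ⟨n, hBl, hnbad, hjn, hwin⟩ :=
    ((hj.filter_mono hUtop).and (hUbad.and
      (((eventually_ge_atTop (j + s)).filter_mono hUtop).and hco))).exists
  obtain ⟨-, -, hbig⟩ := hbad n hnbad
  refine hbig (le_trans ?_ hBl)
  refine abs_corr_le_block (by omega : j ≤ n) (fun N => ((ArithmeticFunction.liouville N : ℤ) : ℝ))
    (fun N => MvPolynomial.eval (fun i : Fin n => if Nat.testBit N i then (1 : ZMod 2) else 0) (Q n))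
    (MvPolynomial.coeff 0 (Q n)) (qd n) quad (ld n) lin (hNF n hnbad) ?_ ?_
  · -- the two linear parts agree below `j`
    intro i hi
    rw [(hwin ⟨i, by omega⟩ ⟨i, by omega⟩).2]
    exact CharTwo.add_self_eq_zero (lin i)
  · -- the two quadratic parts agree unless both indices are `≥ j`
    intro i i' hne
    have hk : j + s ≤ i' := by
      by_contra hlt
      push Not at hlt
      by_cases hi : i < j + s
      · have h1 := (hwin ⟨i, hi⟩ ⟨i', hlt⟩).1
        rw [h1] at hne
        exact hne (CharTwo.add_self_eq_zero (quad i i'))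
      · have hq0 : qd n i i' = 0 := by
          by_contra h0
          have := (hBD n hnbad i i' h0).1
          omega
        have hq1 : quad i i' = 0 := by
          by_contra h0
          have := (hband i i' h0).1
          omega
        rw [hq0, hq1, add_zero] at hne
        exact hne rfl
    by_cases hq : qd n i i' = 0
    · rw [hq, zero_add] at hne
      obtain ⟨h1, h2⟩ := hband i i' hne
      omega
    · obtain ⟨h1, h2⟩ := hBD n hnbad i i' hq
      omega

end Summit.QuantumAdvantage.QuantumAdvantage.Theorems.MobiusLadderQuadraticDigitPhasesStubCompact
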